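import Mathlib.Analysis.SpecialFunctions.Trigonometric.Basic
import Mathlib.Analysis.SpecialFunctions.Trigonometric.Deriv
import Mathlib.Analysis.SpecialFunctions.Trigonometric.Inverse
import Literature.MathematicalPhysics.QuantumLattice.LadderBandIdentities

/-!
# The zigzag (double) chain is the `t₁–t₂` chain: band identities and extrema

The CuO DOUBLE CHAIN of YBa₂Cu₄O₈ / Pr₂Ba₄Cu₇O₁₅ (two edge-sharing CuO chains staggered by half
a period) is modelled in the literature as the one-orbital ZIGZAG CHAIN, i.e. a single chain whose
nearest-neighbour hopping `t₁` is the inter-chain (≈ 90° Cu–O–Cu) path and whose next-nearest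
hopping `t₂` is the intra-chain (180°) path, with the dispersion
`ε(q) = ε₀ + 2 t₁ cos q + 2 t₂ cos 2q` [SanoOno2007, §2 and Fig. 1: `t₁ = −0.10`, `t₂ = −0.45` eV
fitted to the LDA d-band of the Y-124 double chain].  This file records, as proved theorems and
with no named facts:

* `zigzagChain` — the printed dispersion, and `zigzagChain_eq_ladderLegDispersion` (it is the
  chain dispersion of `LadderBandIdentities` with both signs flipped);
* the ZONE-UNFOLDING identity behind "zigzag ladder = `t₁–t₂` chain": written as a two-leg ladder
  at LEG momentum `k` (leg period 1, legs offset by 1/2, Bloch phases at the true positions) the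
  Bloch matrix is `ladderBloch (ε₀ + 2t₂ cos k) (2t₁ cos (k/2))`, whose even/odd eigenvalues are
  EXACTLY `ε(k/2)` and `ε(k/2 + π)` (`zigzag_even_band`, `zigzag_odd_band`, `zigzagBloch_bands`) —
  the two "ladder bands" over the leg zone are the one chain band over the doubled zone;
* zone-edge and interior values (`zigzagChain_zero/pi/half_pi`, `zigzagChain_zero_sub_pi = 4t₁`),
  the completed square `ε(q) = ε₀ − 2t₂ − t₁²/(4t₂) + 4t₂ (cos q + t₁/(4t₂))²`
  (`zigzagChain_complete_square`), hence the INTERIOR extremum at `cos q = −t₁/(4t₂)` with value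
  `ε₀ − 2t₂ − t₁²/(4t₂)`, a global minimum for `t₂ > 0` and a global maximum for `t₂ < 0`
  (`zigzagChain_ge_of_pos`, `zigzagChain_le_of_neg`), which exists inside the zone iff
  `|t₁| ≤ 4|t₂|` (`exists_cos_eq_interior`) — the "double-well band / two Fermi seas" regime of the
  zigzag chain — versus the zone-EDGE extremum when `|t₁| ≥ 4 max(t₂, 0)` (`zigzagChain_pi_le`,
  `zigzagChain_zero_le`, from the factorised differences `zigzagChain_sub_pi/zero`);
* the derivative `ε′(q) = −2 sin q (t₁ + 4 t₂ cos q)` (`hasDerivAt_zigzagChain`);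
* the Sano–Ōno numbers for the Y-124 double chain: zone-edge values `−1.1` and `−0.7` eV, interior
  band top `163/180` eV at `cos q = −1/18`, total width `361/180` eV (`sanoOno2007_y124`).

Not here: interactions (`J₁`, `J₂`, the Luttinger-liquid analysis of [SanoOno2007]), the d–p
double-chain model, inter-double-chain couplings, anything approximate.  Which extremum is
occupied first depends on the electron/hole convention of `t₁, t₂` — not asserted.

References: K. Sano, Y. Ōno, J. Phys. Soc. Jpn. 76 (2007) 113701, arXiv:0709.1206, §2, Fig. 1;
T. Kondo et al., Phys. Rev. Lett. 98 (2007) 157002 (the two quasi-1D chain bands of Y-124).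
AI-produced formalisation (H21, cell hubbard-downfold, seat lit-2, 2026-08-27); no facts, no axioms
beyond Mathlib's, no `sorry`.
-/

namespace Literature.MathematicalPhysics.QuantumLattice

open Real Matrix

/-- The zigzag-chain (`t₁–t₂` chain) dispersion `ε(q) = ε₀ + 2t₁ cos q + 2t₂ cos 2q`: `t₁` the
nearest-neighbour hopping along the zigzag path (inter-chain), `t₂` the next-nearest (intra-chain)
hopping, `q` in units of the inverse zigzag-path spacing. [cite: SanoOno2007, Fig. 1] -/
noncomputable def zigzagChain (ε₀ t₁ t₂ q : ℝ) : ℝ :=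
  ε₀ + 2 * t₁ * cos q + 2 * t₂ * cos (2 * q)

/-- Unfolding. [cite: SanoOno2007, Fig. 1] -/
theorem zigzagChain_def (ε₀ t₁ t₂ q : ℝ) :
    zigzagChain ε₀ t₁ t₂ q = ε₀ + 2 * t₁ * cos q + 2 * t₂ * cos (2 * q) := rfl

/-- The zigzag-chain dispersion is the chain dispersion of `LadderBandIdentities` with both
hopping signs flipped (that file writes `ε₀ − 2t cos k − 2t₂ cos 2k`).
[cite: SanoOno2007, §2 Fig. 1(b)] -/
theorem zigzagChain_eq_ladderLegDispersion (ε₀ t₁ t₂ q : ℝ) :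
    zigzagChain ε₀ t₁ t₂ q = ladderLegDispersion ε₀ (-t₁) (-t₂) q := by
  simp only [zigzagChain, ladderLegDispersion]
  ring

/-- The dispersion is even in `q`. [cite: SanoOno2007, §2 Fig. 1(b)] -/
theorem zigzagChain_neg (ε₀ t₁ t₂ q : ℝ) :
    zigzagChain ε₀ t₁ t₂ (-q) = zigzagChain ε₀ t₁ t₂ q := by
  simp only [zigzagChain, mul_neg, Real.cos_neg]

/-- The dispersion is `2π`-periodic. [cite: SanoOno2007, §2 Fig. 1(b)] -/
theorem zigzagChain_add_two_pi (ε₀ t₁ t₂ q : ℝ) :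
    zigzagChain ε₀ t₁ t₂ (q + 2 * π) = zigzagChain ε₀ t₁ t₂ q := by
  simp only [zigzagChain]
  rw [Real.cos_add_two_pi, show 2 * (q + 2 * π) = 2 * q + 2 * π + 2 * π by ring,
    Real.cos_add_two_pi, Real.cos_add_two_pi]

/-! ## The zigzag ladder at leg momentum `k` and the zone unfolding -/

/-- Intra-leg Bloch entry of the zigzag ladder at leg momentum `k` (leg period 1): on-site `ε₀`
plus the intra-chain hopping `t₂` to the two leg neighbours. [cite: SanoOno2007, Fig. 1(a)–(b)] -/
noncomputable def zigzagLeg (ε₀ t₂ k : ℝ) : ℝ :=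
  ε₀ + 2 * t₂ * cos k

/-- Inter-leg Bloch entry of the zigzag ladder at leg momentum `k` with Bloch phases taken at the
true positions (the second leg offset by half a period): each site couples by `t₁` to the two
sites of the other leg at `± 1/2`, giving `t₁ (e^{ik/2} + e^{−ik/2}) = 2 t₁ cos (k/2)`.
[cite: SanoOno2007, Fig. 1(a)–(b)] -/
noncomputable def zigzagInterLeg (t₁ k : ℝ) : ℝ :=
  2 * t₁ * cos (k / 2)

/-- Unfolding. [cite: SanoOno2007, Fig. 1(a)–(b)] -/
theorem zigzagLeg_def (ε₀ t₂ k : ℝ) : zigzagLeg ε₀ t₂ k = ε₀ + 2 * t₂ * cos k := rfl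

/-- Unfolding. [cite: SanoOno2007, Fig. 1(a)–(b)] -/
theorem zigzagInterLeg_def (t₁ k : ℝ) : zigzagInterLeg t₁ k = 2 * t₁ * cos (k / 2) := rfl

/-- **Zone unfolding, even band**: the even (leg-symmetric) ladder band `a + c` at leg momentum
`k` is the chain dispersion at `q = k/2`. [cite: SanoOno2007, Fig. 1(a)–(b)] -/
theorem zigzag_even_band (ε₀ t₁ t₂ k : ℝ) :
    zigzagLeg ε₀ t₂ k + zigzagInterLeg t₁ k = zigzagChain ε₀ t₁ t₂ (k / 2) := by
  simp only [zigzagLeg, zigzagInterLeg, zigzagChain]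
  rw [show 2 * (k / 2) = k by ring]
  ring

/-- **Zone unfolding, odd band**: the odd (leg-antisymmetric) ladder band `a − c` at leg momentum
`k` is the chain dispersion at `q = k/2 + π` (the other half of the doubled zone).
[cite: SanoOno2007, Fig. 1(a)–(b)] -/
theorem zigzag_odd_band (ε₀ t₁ t₂ k : ℝ) :
    zigzagLeg ε₀ t₂ k - zigzagInterLeg t₁ k = zigzagChain ε₀ t₁ t₂ (k / 2 + π) := by
  simp only [zigzagLeg, zigzagInterLeg, zigzagChain]
  rw [Real.cos_add_pi, show 2 * (k / 2 + π) = k + 2 * π by ring, Real.cos_add_two_pi]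
  ring

/-- The two zigzag-ladder bands as eigenpairs of the `2 × 2` Bloch matrix
`ladderBloch (zigzagLeg ε₀ t₂ k) (zigzagInterLeg t₁ k)`: eigenvectors `(1, 1)` and `(1, −1)` with
eigenvalues `ε(k/2)` and `ε(k/2 + π)` of the ONE-band zigzag chain.
[cite: SanoOno2007, Fig. 1(a)–(b)] -/
theorem zigzagBloch_bands (ε₀ t₁ t₂ k : ℝ) :
    ladderBloch (zigzagLeg ε₀ t₂ k) (zigzagInterLeg t₁ k) *ᵥ ![1, 1]
        = zigzagChain ε₀ t₁ t₂ (k / 2) • ![1, 1] ∧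
      ladderBloch (zigzagLeg ε₀ t₂ k) (zigzagInterLeg t₁ k) *ᵥ ![1, -1]
        = zigzagChain ε₀ t₁ t₂ (k / 2 + π) • ![1, -1] := by
  constructor
  · rw [ladderBloch_mulVec_even, zigzag_even_band]
  · rw [ladderBloch_mulVec_odd, zigzag_odd_band]

/-! ## Special values, completed square, extrema -/

/-- Zone-centre value `ε(0) = ε₀ + 2t₁ + 2t₂`. [cite: SanoOno2007, §2 Fig. 1(b)] -/
theorem zigzagChain_zero (ε₀ t₁ t₂ : ℝ) : zigzagChain ε₀ t₁ t₂ 0 = ε₀ + 2 * t₁ + 2 * t₂ := by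
  simp [zigzagChain]

/-- Zone-edge value `ε(π) = ε₀ − 2t₁ + 2t₂`. [cite: SanoOno2007, §2 Fig. 1(b)] -/
theorem zigzagChain_pi (ε₀ t₁ t₂ : ℝ) : zigzagChain ε₀ t₁ t₂ π = ε₀ - 2 * t₁ + 2 * t₂ := by
  simp only [zigzagChain, Real.cos_pi]
  rw [show (2 : ℝ) * π = 0 + 2 * π by ring, Real.cos_add_two_pi, Real.cos_zero]
  ring

/-- The two candidate edge extrema differ by exactly `4t₁`: `ε(0) − ε(π) = 4t₁` (independent of
`t₂`). [cite: SanoOno2007, §2 Fig. 1(b)] -/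
theorem zigzagChain_zero_sub_pi (ε₀ t₁ t₂ : ℝ) :
    zigzagChain ε₀ t₁ t₂ 0 - zigzagChain ε₀ t₁ t₂ π = 4 * t₁ := by
  rw [zigzagChain_zero, zigzagChain_pi]
  ring

/-- Quarter-zone value `ε(π/2) = ε₀ − 2t₂` (independent of `t₁`). [cite: SanoOno2007, §2 Fig. 1(b)] -/
theorem zigzagChain_half_pi (ε₀ t₁ t₂ : ℝ) : zigzagChain ε₀ t₁ t₂ (π / 2) = ε₀ - 2 * t₂ := by
  simp only [zigzagChain, Real.cos_pi_div_two]
  rw [mul_div_cancel₀ π two_ne_zero, Real.cos_pi]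
  ring

/-- **Completed square**: for `t₂ ≠ 0`,
`ε(q) = ε₀ − 2t₂ − t₁²/(4t₂) + 4t₂ (cos q + t₁/(4t₂))²`. [cite: SanoOno2007, §2 Fig. 1(b)] -/
theorem zigzagChain_complete_square (ε₀ t₁ t₂ q : ℝ) (ht₂ : t₂ ≠ 0) :
    zigzagChain ε₀ t₁ t₂ q
      = ε₀ - 2 * t₂ - t₁ ^ 2 / (4 * t₂) + 4 * t₂ * (cos q + t₁ / (4 * t₂)) ^ 2 := by
  simp only [zigzagChain, Real.cos_two_mul]
  field_simp
  ring

/-- Value at an interior critical point `cos q = −t₁/(4t₂)`: `ε = ε₀ − 2t₂ − t₁²/(4t₂)`.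
[cite: SanoOno2007, §2 Fig. 1(b)] -/
theorem zigzagChain_at_interior (ε₀ t₁ t₂ q : ℝ) (ht₂ : t₂ ≠ 0)
    (hq : cos q = -t₁ / (4 * t₂)) :
    zigzagChain ε₀ t₁ t₂ q = ε₀ - 2 * t₂ - t₁ ^ 2 / (4 * t₂) := by
  rw [zigzagChain_complete_square ε₀ t₁ t₂ q ht₂, hq]
  ring

/-- For `t₂ > 0` the interior value is a GLOBAL LOWER bound of the band (attained iff
`cos q = −t₁/(4t₂)`, possible iff `|t₁| ≤ 4t₂`: the double-well band). [cite: SanoOno2007, §2 Fig. 1(b)] -/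
theorem zigzagChain_ge_of_pos (ε₀ t₁ t₂ q : ℝ) (ht₂ : 0 < t₂) :
    ε₀ - 2 * t₂ - t₁ ^ 2 / (4 * t₂) ≤ zigzagChain ε₀ t₁ t₂ q := by
  rw [zigzagChain_complete_square ε₀ t₁ t₂ q ht₂.ne']
  have h : 0 ≤ 4 * t₂ * (cos q + t₁ / (4 * t₂)) ^ 2 := by positivity
  linarith

/-- For `t₂ < 0` the interior value is a GLOBAL UPPER bound of the band (the band top lies inside
the zone when `|t₁| ≤ 4|t₂|`). [cite: SanoOno2007, §2 Fig. 1(b)] -/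
theorem zigzagChain_le_of_neg (ε₀ t₁ t₂ q : ℝ) (ht₂ : t₂ < 0) :
    zigzagChain ε₀ t₁ t₂ q ≤ ε₀ - 2 * t₂ - t₁ ^ 2 / (4 * t₂) := by
  rw [zigzagChain_complete_square ε₀ t₁ t₂ q ht₂.ne]
  have h : 4 * t₂ * (cos q + t₁ / (4 * t₂)) ^ 2 ≤ 0 :=
    mul_nonpos_of_nonpos_of_nonneg (by linarith) (sq_nonneg _)
  linarith

/-- The interior critical point EXISTS in the zone iff `−1 ≤ −t₁/(4t₂) ≤ 1`, i.e. iff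
`|t₁| ≤ 4|t₂|` (`t₂ ≠ 0`): then `q = arccos(−t₁/(4t₂)) ∈ [0, π]` has `cos q = −t₁/(4t₂)`.
[cite: SanoOno2007, §2 Fig. 1(b)] -/
theorem exists_cos_eq_interior (t₁ t₂ : ℝ) (ht₂ : t₂ ≠ 0) (h : |t₁| ≤ 4 * |t₂|) :
    ∃ q : ℝ, 0 ≤ q ∧ q ≤ π ∧ cos q = -t₁ / (4 * t₂) := by
  have h4 : 0 < |4 * t₂| := by positivity
  have hx : |(-t₁) / (4 * t₂)| ≤ 1 := by
    rw [abs_div, abs_neg, div_le_one h4, abs_mul, abs_of_pos (by norm_num : (0:ℝ) < 4)]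
    exact h
  refine ⟨arccos (-t₁ / (4 * t₂)), arccos_nonneg _, arccos_le_pi _, ?_⟩
  rw [cos_arccos (neg_le_of_abs_le hx) (le_of_abs_le hx)]

/-- Factorised difference to the zone edge `π`:
`ε(q) − ε(π) = 2 (1 + cos q) (t₁ − 2t₂ (1 − cos q))`. [cite: SanoOno2007, §2 Fig. 1(b)] -/
theorem zigzagChain_sub_pi (ε₀ t₁ t₂ q : ℝ) :
    zigzagChain ε₀ t₁ t₂ q - zigzagChain ε₀ t₁ t₂ π
      = 2 * (1 + cos q) * (t₁ - 2 * t₂ * (1 - cos q)) := by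
  rw [zigzagChain_pi]
  simp only [zigzagChain, Real.cos_two_mul]
  ring

/-- Factorised difference to the zone centre:
`ε(q) − ε(0) = −2 (1 − cos q) (t₁ + 2t₂ (1 + cos q))`. [cite: SanoOno2007, §2 Fig. 1(b)] -/
theorem zigzagChain_sub_zero (ε₀ t₁ t₂ q : ℝ) :
    zigzagChain ε₀ t₁ t₂ q - zigzagChain ε₀ t₁ t₂ 0
      = -2 * (1 - cos q) * (t₁ + 2 * t₂ * (1 + cos q)) := by
  rw [zigzagChain_zero]
  simp only [zigzagChain, Real.cos_two_mul]
  ring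

/-- **Edge minimum at `π`**: if `t₁ ≥ 4 max(t₂, 0)` the band minimum sits at the zone edge `q = π`
(no interior minimum). [cite: SanoOno2007, §2 Fig. 1(b)] -/
theorem zigzagChain_pi_le (ε₀ t₁ t₂ q : ℝ) (h : 4 * max t₂ 0 ≤ t₁) :
    zigzagChain ε₀ t₁ t₂ π ≤ zigzagChain ε₀ t₁ t₂ q := by
  have hc1 : 0 ≤ 1 + cos q := by linarith [neg_one_le_cos q]
  have hc2 : 1 - cos q ≤ 2 := by linarith [neg_one_le_cos q]
  have hc3 : 0 ≤ 1 - cos q := by linarith [cos_le_one q]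
  have hm : t₂ ≤ max t₂ 0 := le_max_left _ _
  have hm0 : 0 ≤ max t₂ 0 := le_max_right _ _
  have key : 0 ≤ t₁ - 2 * t₂ * (1 - cos q) := by
    nlinarith
  have := zigzagChain_sub_pi ε₀ t₁ t₂ q
  nlinarith

/-- **Edge minimum at `0`**: if `t₁ ≤ −4 max(t₂, 0)` the band minimum sits at the zone centre
`q = 0`. [cite: SanoOno2007, §2 Fig. 1(b)] -/
theorem zigzagChain_zero_le (ε₀ t₁ t₂ q : ℝ) (h : t₁ ≤ -(4 * max t₂ 0)) :
    zigzagChain ε₀ t₁ t₂ 0 ≤ zigzagChain ε₀ t₁ t₂ q := by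
  have hc1 : 0 ≤ 1 - cos q := by linarith [cos_le_one q]
  have hc2 : 1 + cos q ≤ 2 := by linarith [cos_le_one q]
  have hc3 : 0 ≤ 1 + cos q := by linarith [neg_one_le_cos q]
  have hm : t₂ ≤ max t₂ 0 := le_max_left _ _
  have hm0 : 0 ≤ max t₂ 0 := le_max_right _ _
  have key : t₁ + 2 * t₂ * (1 + cos q) ≤ 0 := by
    nlinarith
  have := zigzagChain_sub_zero ε₀ t₁ t₂ q
  nlinarith

/-! ## Derivative -/

/-- `ε′(q) = −2t₁ sin q − 4t₂ sin 2q`. [cite: SanoOno2007, §2 Fig. 1(b)] -/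
theorem hasDerivAt_zigzagChain (ε₀ t₁ t₂ q : ℝ) :
    HasDerivAt (zigzagChain ε₀ t₁ t₂) (-2 * t₁ * sin q - 4 * t₂ * sin (2 * q)) q := by
  have h1 : HasDerivAt (fun x : ℝ => 2 * t₁ * cos x) (2 * t₁ * (-sin q)) q :=
    (Real.hasDerivAt_cos q).const_mul (2 * t₁)
  have h2 : HasDerivAt (fun x : ℝ => 2 * t₂ * cos (2 * x)) (2 * t₂ * (-sin (2 * q) * 2)) q := by
    have hl : HasDerivAt (fun x : ℝ => 2 * x) 2 q := by
      simpa using (hasDerivAt_id q).const_mul (2 : ℝ)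
    exact ((Real.hasDerivAt_cos (2 * q)).comp q hl).const_mul (2 * t₂)
  have h3 : HasDerivAt (fun x : ℝ => ε₀ + 2 * t₁ * cos x + 2 * t₂ * cos (2 * x))
      (0 + 2 * t₁ * (-sin q) + 2 * t₂ * (-sin (2 * q) * 2)) q :=
    ((hasDerivAt_const q ε₀).add h1).add h2
  have e : (0 : ℝ) + 2 * t₁ * (-sin q) + 2 * t₂ * (-sin (2 * q) * 2)
      = -2 * t₁ * sin q - 4 * t₂ * sin (2 * q) := by ring
  have hf : zigzagChain ε₀ t₁ t₂ = fun x : ℝ => ε₀ + 2 * t₁ * cos x + 2 * t₂ * cos (2 * x) := rfl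
  rw [hf, ← e]
  exact h3

/-- The derivative factorises: `−2t₁ sin q − 4t₂ sin 2q = −2 sin q (t₁ + 4t₂ cos q)`, so the
critical points are `sin q = 0` (zone centre/edge) or `cos q = −t₁/(4t₂)` (interior).
[cite: SanoOno2007, §2 Fig. 1(b)] -/
theorem zigzagChain_deriv_factor (t₁ t₂ q : ℝ) :
    -2 * t₁ * sin q - 4 * t₂ * sin (2 * q) = -2 * sin q * (t₁ + 4 * t₂ * cos q) := by
  rw [Real.sin_two_mul]
  ring

/-! ## The Y-124 double chain of [SanoOno2007] -/

/-- **Sano–Ōno numbers for the YBa₂Cu₄O₈ double chain** (`ε₀ = 0`, `t₁ = −0.10`, `t₂ = −0.45` eV,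
fitted to the LDA d-band of the double chain): zone-centre value `−1.1` eV, zone-edge value
`−0.7` eV (difference `4t₁ = −0.4`), `|t₁| ≤ 4|t₂|` so the band TOP lies inside the zone at
`cos q = −t₁/(4t₂) = −1/18` with value `−2t₂ − t₁²/(4t₂) = 163/180` eV (≈ 0.906), an upper bound
for all `q`; total width `163/180 + 11/10 = 361/180` eV (≈ 2.01). [cite: SanoOno2007, §2 Fig. 1] -/
theorem sanoOno2007_y124 :
    zigzagChain 0 (-1/10) (-9/20) 0 = -11/10 ∧
      zigzagChain 0 (-1/10) (-9/20) π = -7/10 ∧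
      |(-1/10 : ℝ)| ≤ 4 * |(-9/20 : ℝ)| ∧
      -(-1/10 : ℝ) / (4 * (-9/20)) = -1/18 ∧
      (0 : ℝ) - 2 * (-9/20) - (-1/10) ^ 2 / (4 * (-9/20)) = 163/180 ∧
      (∀ q : ℝ, zigzagChain 0 (-1/10) (-9/20) q ≤ 163/180) ∧
      (163/180 : ℝ) - (-11/10) = 361/180 := by
  refine ⟨?_, ?_, ?_, ?_, ?_, ?_, ?_⟩
  · rw [zigzagChain_zero]; norm_num
  · rw [zigzagChain_pi]; norm_num
  · rw [abs_of_neg (by norm_num : (-1/10 : ℝ) < 0), abs_of_neg (by norm_num : (-9/20 : ℝ) < 0)]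
    norm_num
  · norm_num
  · norm_num
  · intro q
    have h := zigzagChain_le_of_neg 0 (-1/10) (-9/20) q (by norm_num)
    have e : (0 : ℝ) - 2 * (-9/20) - (-1/10) ^ 2 / (4 * (-9/20)) = 163/180 := by norm_num
    linarith
  · norm_num

end Literature.MathematicalPhysics.QuantumLattice
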